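import Literature.AlgebraicGeometry.HodgeTheory.AbelianVarietySubvarietyIsotypicPieces
import Literature.AlgebraicGeometry.Motives.AbelianVarietySimpleFactorsUnique
import HarnessLib

/-!
# The isotypic pieces of a QUOTIENT: for a surjective homomorphism `f : X ↠ Z` and the isotypic projectors `u_q` of `X`,
# the pieces `Z_q := f(Y_q) = im(u_q ≫ f) ↪ Z` are pairwise `Hom`-orthogonal, a quasi-section maps `Z_q` finitely into
# `Y_q`, and the addition map `⨁_q f(Y_q) → Z` is an isogeny; every quotient ∕ finite cover of `X ⊇ ⨁_q Y_q`,
# `Y_q ∼ B_q^{n_q+1}`, is `∼ ⨁_q B_q^{s_q}` with `s_q ≤ n_q + 1` (Mumford §19 Thm. 1, Cor. 1–2; Milne 1986 §12 Prop. 12.1)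

Layer `Literature/AlgebraicGeometry/HodgeTheory`; theorems only (no `def`, no instance, no named fact; net debt 0).  The dual
of `…SubvarietyIsotypicPieces`: §1 holds over ANY field for a `Hom`-orthogonal system of abelian subvarieties `i_q : Y_q ↪ X`
whose addition map `desc i` is an isogeny with quasi-inverse `v` (`desc i ≫ v = m • 𝟙`, `v ≫ desc i = m • 𝟙`, `m ≠ 0`), the
central projectors `u_q = (v ≫ π_q) ≫ i_q`, and a surjective `f : X ↠ Z` with a quasi-SECTION `t : Z → X`
(`t ≫ f = N • 𝟙`, `N ≠ 0`); §2 discharges `v`, `t` and the orthogonality over a PERFECT field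
(`Motives.AbelianVariety.exists_quasiSection_of_perfectField`).

THE PRINT.  Mumford, *Abelian Varieties* §19 Thm. 1 (p. 173), Remark p. 169 (quasi-inverses), Cor. 1–2 (pp. 173–174:
`X ∼ ∏ X_i^{n_i}` uniquely, `End⁰(X) = ⊕ M_{n_i}(D_i)`); Milne 1986 §12 Prop. 12.1 and its proof (PDF p. 189: the
decomposition passes to quotients through a quasi-section); Silverberg–Zarhin 2015 proof of Lemma 3.3 (p. 5: the addition
map of the isotypic components of ANY abelian variety is an isogeny, distinct components are `Hom`-orthogonal) — here for
the quotient `Z`, whose pieces are exhibited as the images `f(Y_q)`.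

THE ARGUMENT.  `range (u_q ≫ f) = f(range u_q) = f(Y_q)` (`range u_q = range i_q`).  The endomorphism `f ≫ t ∈ End X`
commutes with the central `u_q`, so `t(Z_q) = range(u_q ≫ f ≫ t) = range((f ≫ t) ≫ u_q) ⊆ Y_q`: the quasi-section restricts
to a FINITE `t_q : Z_q → Y_q` (`t_q ≫ i_q = (Z_q ↪ Z) ≫ t`).  The addition map `⨁_q Z_q → Z` is SURJECTIVE since
`[m] ≫ f = Σ_q u_q ≫ f` factors through it, and FINITE since followed by `t` it equals `(⊕_q t_q) ≫ desc i`, finite.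
Orthogonality: for `g : Z_q → Z_{q'}`, `c_q ≫ g ≫ t_{q'} ∈ Hom(Y_q, Y_{q'}) = 0` with `c_q : Y_q ↠ Z_q`, and
`t_{q'} ≫ i_{q'} ≫ f = N • (Z_{q'} ↪ Z)`, so `N • g = 0`, `g = 0` (`Hom` is torsion-free, Milne Lemma 12.2).

Results (namespace `Literature.AlgebraicGeometry.HodgeTheory.AbelianVariety`):
* §1 (any field) `range_isotypicProjector_comp_eq` (`range (u_q ≫ f) = range (i_q ≫ f)`: `Z_q = f(Y_q)`),
  `exists_surjective_comp_imageι_quotientPiece_eq` (`c_q : Y_q ↠ Z_q`, `c_q ≫ (Z_q ↪ Z) = i_q ≫ f`),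
  `range_quotientPiece_comp_quasiSection_subset` (`t(Z_q) ⊆ Y_q`), **`exists_isFinite_restrict_quasiSection`** (finite
  `t_q : Z_q → Y_q`, `t_q ≫ i_q = (Z_q ↪ Z) ≫ t`), `nsmul_id_comp_eq_lift_comp_desc_quotientPieces` (`[m] ≫ f` factors through
  the addition map), **`isIsogeny_biproduct_desc_imageι_quotientPieces`** (`⨁_q f(Y_q) → Z` is an isogeny),
  `dim_eq_sum_dim_quotientPieces`, `hom_quotientPieces_eq_zero` (`Hom(Z_q, Z_{q'}) = 0` for `q ≠ q'`);
* §2 (perfect field; isotypic components `Y_q ∼ B_q^{n_q+1}` of `X`) **`exists_quotientPieces_of_surjective`** (every quotient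
  `f : X ↠ Z`: the abelian subvarieties `f(Y_q) ↪ Z` are pairwise `Hom`-orthogonal, of types `B_q^{s_q}`, `s_q ≤ n_q + 1`,
  with addition map an isogeny), **`exists_isIsogenous_biproduct_powers_le_of_surjective`** ∕ `…_of_isFinite` (every
  quotient ∕ finite cover of `X` is `∼ ⨁_q B_q^{s_q}`, `s_q ≤ n_q + 1`, on the index set of `X`),
  `exists_dim_eq_sum_mul_of_surjective` ∕ `…_of_isFinite`.

## References
* [MumfordAV1970] D. Mumford, *Abelian Varieties* (1970), §19 Thm. 1, Remark p. 169, Cor. 1–2 (pp. 169–174).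
* [Milne1986AbelianVarieties] J. S. Milne, *Abelian Varieties*, in Cornell–Silverman (1986), §12 Prop. 12.1 and its proof,
  Lemma 12.2, p. 122 (PDF p. 189); §8 Prop. 8.1 (PDF p. 180).
* [SilverbergZarhin2015] A. Silverberg, Yu. G. Zarhin, *Isogenies of abelian varieties over finite fields* (2015) (arXiv:1409.0592),
  Def. 2.3 (p. 3), proof of Lemma 3.3 (p. 5).
* [GortzWedhorn2020] U. Görtz, T. Wedhorn, *Algebraic Geometry I: Schemes*, 2nd ed. (2020), Remark 10.32 (PDF p. 312),
  Cor. 16.56 (1) (PDF p. 678).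
-/

noncomputable section

universe u

open CategoryTheory CategoryTheory.Limits

namespace Literature.AlgebraicGeometry.HodgeTheory

namespace AbelianVariety

open _root_.AlgebraicGeometry
open Literature.AlgebraicGeometry.Motives Literature.AlgebraicGeometry.Motives.AbelianVariety

variable {K : Type u} [Field K]

/-! ## §1 The pieces `f(Y_q)` of a quotient (any field) -/

section AnyField

variable {Q : Type} [Fintype Q] {X Z : Motives.AbelianVariety K} {Y : Q → Motives.AbelianVariety K} (i : ∀ q, Y q ⟶ X)
  {v : X ⟶ ⨁ Y} {m : ℕ} (f : X ⟶ Z)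

/-- **`Z_q = f(Y_q)`**: `range (u_q ≫ f) = range (i_q ≫ f)` (`range u_q = range i_q`, `m ≠ 0`).
[cite: MumfordAV1970, §19 Thm. 1 (p. 173) and Remark p. 169] [cite: GortzWedhorn2020, Remark 10.32 (PDF p. 312)] -/
theorem range_isotypicProjector_comp_eq (hdv : biproduct.desc i ≫ v = m • 𝟙 (⨁ Y)) (hm : m ≠ 0) (q : Q) :
    Set.range (Hom.toSchemeHom (((v ≫ biproduct.π Y q) ≫ i q) ≫ f)) = Set.range (Hom.toSchemeHom (i q ≫ f)) := by
  rw [range_toSchemeHom_comp_eq_image, range_isotypicProjector i hdv hm q, ← range_toSchemeHom_comp_eq_image]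

/-- `Y_q ↠ Z_q`: a surjective `c_q : Y_q → im(u_q ≫ f)` with `c_q ≫ (Z_q ↪ Z) = i_q ≫ f`. [cite: MumfordAV1970, §19 Thm. 1 (p. 173)]
[cite: GortzWedhorn2020, Remark 10.32 (PDF p. 312) and Cor. 16.56 (1) (PDF p. 678)] -/
theorem exists_surjective_comp_imageι_quotientPiece_eq (hdv : biproduct.desc i ≫ v = m • 𝟙 (⨁ Y)) (hm : m ≠ 0)
    (q : Q) : ∃ c : Y q ⟶ image (((v ≫ biproduct.π Y q) ≫ i q) ≫ f), Surjective (Hom.toSchemeHom c) ∧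
      c ≫ imageι (((v ≫ biproduct.π Y q) ≫ i q) ≫ f) = i q ≫ f := by
  have hr : Set.range (Hom.toSchemeHom (i q ≫ f)) =
      Set.range (Hom.toSchemeHom (imageι (((v ≫ biproduct.π Y q) ≫ i q) ≫ f))) := by
    rw [range_toSchemeHom_imageι, range_isotypicProjector_comp_eq i f hdv hm q]
  obtain ⟨c, hc, -⟩ := existsUnique_hom_comp_eq_of_range_subset (i q ≫ f) _ hr.le
  exact ⟨c, surjective_of_range_comp_eq c _ (by rw [hc, hr]), hc⟩

/-- **`t(Z_q) ⊆ Y_q`**: a quasi-section `t` of `f` maps the piece `Z_q = im(u_q ≫ f)` into the component `Y_q` — the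
endomorphism `f ≫ t` of `X` commutes with the CENTRAL projector `u_q`. [cite: MumfordAV1970, §19 Cor. 2 of Thm. 1 (p. 174) and Remark p. 169]
[cite: Milne1986AbelianVarieties, §12 Prop. 12.1 and its proof (PDF p. 189)] -/
theorem range_quotientPiece_comp_quasiSection_subset (hi : ∀ q, IsClosedImmersion (Hom.toSchemeHom (i q)))
    (hdesc : IsIsogeny (biproduct.desc i)) (hdv : biproduct.desc i ≫ v = m • 𝟙 (⨁ Y))
    (horth : ∀ q q', q ≠ q' → ∀ g : Y q ⟶ Y q', g = 0) (t : Z ⟶ X) (q : Q) :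
    Set.range (Hom.toSchemeHom (imageι (((v ≫ biproduct.π Y q) ≫ i q) ≫ f) ≫ t)) ⊆
      Set.range (Hom.toSchemeHom (i q)) := by
  rw [← range_toSchemeHom_comp_eq_of_surjective (toImage (((v ≫ biproduct.π Y q) ≫ i q) ≫ f)) (imageι _ ≫ t),
    ← Category.assoc (toImage _) (imageι _) t, toImage_imageι, Category.assoc ((v ≫ biproduct.π Y q) ≫ i q) f t,
    ← isotypicProjector_comm i hi hdesc hdv horth (f ≫ t) q, ← Category.assoc (f ≫ t) (v ≫ biproduct.π Y q) (i q)]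
  exact range_toSchemeHom_comp_subset _ (i q)

/-- **The quasi-section restricts to a FINITE `t_q : Z_q → Y_q`** with `t_q ≫ i_q = (Z_q ↪ Z) ≫ t` (any field;
`t ≫ f = N • 𝟙`, `N ≠ 0`). [cite: Milne1986AbelianVarieties, §12 Prop. 12.1 and its proof (PDF p. 189)]
[cite: MumfordAV1970, §19 Remark p. 169 and Cor. 2 (p. 174)] -/
theorem exists_isFinite_restrict_quasiSection (hi : ∀ q, IsClosedImmersion (Hom.toSchemeHom (i q)))
    (hdesc : IsIsogeny (biproduct.desc i)) (hdv : biproduct.desc i ≫ v = m • 𝟙 (⨁ Y))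
    (horth : ∀ q q', q ≠ q' → ∀ g : Y q ⟶ Y q', g = 0) {t : Z ⟶ X} {N : ℕ} (hN : N ≠ 0) (htf : t ≫ f = N • 𝟙 Z)
    (q : Q) : ∃ tq : image (((v ≫ biproduct.π Y q) ≫ i q) ≫ f) ⟶ Y q, IsFinite (Hom.toSchemeHom tq) ∧
      tq ≫ i q = imageι (((v ≫ biproduct.π Y q) ≫ i q) ≫ f) ≫ t := by
  haveI := hi q
  obtain ⟨tq, htq, -⟩ := existsUnique_hom_comp_eq_of_range_subset _ (i q)
    (range_quotientPiece_comp_quasiSection_subset i f hi hdesc hdv horth t q)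
  refine ⟨tq, ?_, htq⟩
  haveI : IsFinite (Hom.toSchemeHom t) := isFinite_of_comp_eq_nsmul_id hN htf
  haveI : IsFinite (Hom.toSchemeHom (imageι (((v ≫ biproduct.π Y q) ≫ i q) ≫ f) ≫ t)) := isFinite_toSchemeHom_comp _ _
  haveI : IsFinite (Hom.toSchemeHom (tq ≫ i q)) := by rw [htq]; infer_instance
  exact isFinite_of_isFinite_comp tq (i q)

/-- `[m] ≫ f = lift(toImage (u_q ≫ f)) ≫ desc (Z_q ↪ Z)`: `m • f = Σ_q u_q ≫ f` factors through the addition map of the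
pieces. [cite: MumfordAV1970, §19 Thm. 1 (p. 173) and Cor. 2 (p. 174)] -/
theorem nsmul_id_comp_eq_lift_comp_desc_quotientPieces (hvd : v ≫ biproduct.desc i = m • 𝟙 X) :
    (m • 𝟙 X) ≫ f = biproduct.lift (fun q ↦ toImage (((v ≫ biproduct.π Y q) ≫ i q) ≫ f)) ≫
      biproduct.desc (fun q ↦ imageι (((v ≫ biproduct.π Y q) ≫ i q) ≫ f)) := by
  classical
  rw [biproduct.lift_desc, ← sum_isotypicProjector i hvd, Preadditive.sum_comp]
  exact Finset.sum_congr rfl fun q _ ↦ (toImage_imageι _).symm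

/-- **THE ADDITION MAP `⨁_q f(Y_q) → Z` OF THE PIECES OF A QUOTIENT IS AN ISOGENY** (any field; `Hom`-orthogonal system
with quasi-inverse, `f : X ↠ Z` surjective with a quasi-section): surjective because `[m] ≫ f` factors through it, finite
because followed by `t` it is `(⊕_q t_q) ≫ desc i`. [cite: MumfordAV1970, §19 Thm. 1 (p. 173), Remark p. 169 and Cor. 1–2 (pp. 173–174)]
[cite: Milne1986AbelianVarieties, §12 Prop. 12.1 and its proof (PDF p. 189)] [cite: SilverbergZarhin2015, proof of Lemma 3.3 (p. 5)] -/
theorem isIsogeny_biproduct_desc_imageι_quotientPieces (hi : ∀ q, IsClosedImmersion (Hom.toSchemeHom (i q)))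
    (hdesc : IsIsogeny (biproduct.desc i)) (hdv : biproduct.desc i ≫ v = m • 𝟙 (⨁ Y))
    (hvd : v ≫ biproduct.desc i = m • 𝟙 X) (horth : ∀ q q', q ≠ q' → ∀ g : Y q ⟶ Y q', g = 0) (hm : m ≠ 0)
    [Surjective (Hom.toSchemeHom f)] {t : Z ⟶ X} {N : ℕ} (hN : N ≠ 0) (htf : t ≫ f = N • 𝟙 Z) :
    IsIsogeny (biproduct.desc fun q ↦ imageι (((v ≫ biproduct.π Y q) ≫ i q) ≫ f)) := by
  classical
  refine ⟨?_, ?_⟩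
  · -- surjective: `[m] ≫ f` is surjective and factors through the addition map
    haveI : Surjective (Hom.toSchemeHom (m • 𝟙 X)) := (isIsogeny_nsmul_id X hm).1
    haveI : Surjective (Hom.toSchemeHom ((m • 𝟙 X) ≫ f)) := by
      change Surjective (Hom.toSchemeHom (m • 𝟙 X) ≫ Hom.toSchemeHom f)
      infer_instance
    haveI : Surjective (Hom.toSchemeHom (biproduct.lift (fun q ↦ toImage (((v ≫ biproduct.π Y q) ≫ i q) ≫ f)) ≫
        biproduct.desc (fun q ↦ imageι (((v ≫ biproduct.π Y q) ≫ i q) ≫ f)))) := by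
      rw [← nsmul_id_comp_eq_lift_comp_desc_quotientPieces i f hvd]
      infer_instance
    exact surjective_of_surjective_comp (biproduct.lift fun q ↦ toImage (((v ≫ biproduct.π Y q) ≫ i q) ≫ f)) _
  · -- finite: `desc (imageι) ≫ t = map tq ≫ desc i`
    choose tq htf' htq using fun q ↦ exists_isFinite_restrict_quasiSection i f hi hdesc hdv horth hN htf q
    have hfac : biproduct.desc (fun q ↦ imageι (((v ≫ biproduct.π Y q) ≫ i q) ≫ f)) ≫ t =
        biproduct.map tq ≫ biproduct.desc i :=
      biproduct.hom_ext' _ _ fun q ↦ by rw [biproduct.ι_desc_assoc, biproduct.ι_map_assoc, biproduct.ι_desc, htq]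
    haveI : ∀ q, IsFinite (Hom.toSchemeHom (tq q)) := htf'
    haveI := isFinite_toSchemeHom_biproduct_map tq
    haveI : IsFinite (Hom.toSchemeHom (biproduct.desc i)) := hdesc.2
    haveI : IsFinite (Hom.toSchemeHom (biproduct.map tq ≫ biproduct.desc i)) := isFinite_toSchemeHom_comp _ _
    haveI : IsFinite (Hom.toSchemeHom (biproduct.desc (fun q ↦ imageι (((v ≫ biproduct.π Y q) ≫ i q) ≫ f)) ≫ t)) := by
      rw [hfac]; infer_instance
    exact isFinite_of_isFinite_comp _ t

/-- `dim Z = Σ_q dim f(Y_q)` for a quotient `f : X ↠ Z` (any field, hypotheses as above).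
[cite: MumfordAV1970, §19 Cor. 1 of Thm. 1 (p. 173)] [cite: Milne1986AbelianVarieties, §12 Prop. 12.1 (PDF p. 189)] -/
theorem dim_eq_sum_dim_quotientPieces (hi : ∀ q, IsClosedImmersion (Hom.toSchemeHom (i q)))
    (hdesc : IsIsogeny (biproduct.desc i)) (hdv : biproduct.desc i ≫ v = m • 𝟙 (⨁ Y))
    (hvd : v ≫ biproduct.desc i = m • 𝟙 X) (horth : ∀ q q', q ≠ q' → ∀ g : Y q ⟶ Y q', g = 0) (hm : m ≠ 0)
    [Surjective (Hom.toSchemeHom f)] {t : Z ⟶ X} {N : ℕ} (hN : N ≠ 0) (htf : t ≫ f = N • 𝟙 Z) :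
    Z.dim = ∑ q, (image (((v ≫ biproduct.π Y q) ≫ i q) ≫ f)).dim := by
  rw [← dim_eq_of_isIsogeny (isIsogeny_biproduct_desc_imageι_quotientPieces i f hi hdesc hdv hvd horth hm hN htf),
    dim_biproduct]

/-- **The pieces of a quotient are pairwise `Hom`-orthogonal**: `Hom(f(Y_q), f(Y_{q'})) = 0` for `q ≠ q'` (any field):
`c_q ≫ g ≫ t_{q'} ∈ Hom(Y_q, Y_{q'}) = 0`, `t_{q'} ≫ i_{q'} ≫ f = N • (Z_{q'} ↪ Z)`, and `Hom` is torsion-free.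
[cite: MumfordAV1970, §19 Cor. 2 of Thm. 1 (p. 174)] [cite: Milne1986AbelianVarieties, §12 Lemma 12.2 and p. 122 (PDF p. 189)]
[cite: SilverbergZarhin2015, proof of Lemma 3.3 (p. 5)] -/
theorem hom_quotientPieces_eq_zero (hi : ∀ q, IsClosedImmersion (Hom.toSchemeHom (i q)))
    (hdesc : IsIsogeny (biproduct.desc i)) (hdv : biproduct.desc i ≫ v = m • 𝟙 (⨁ Y))
    (horth : ∀ q q', q ≠ q' → ∀ g : Y q ⟶ Y q', g = 0) (hm : m ≠ 0) {t : Z ⟶ X} {N : ℕ} (hN : N ≠ 0)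
    (htf : t ≫ f = N • 𝟙 Z) {q q' : Q} (hqq' : q ≠ q')
    (g : image (((v ≫ biproduct.π Y q) ≫ i q) ≫ f) ⟶ image (((v ≫ biproduct.π Y q') ≫ i q') ≫ f)) : g = 0 := by
  obtain ⟨c, hc, hcι⟩ := exists_surjective_comp_imageι_quotientPiece_eq i f hdv hm q
  obtain ⟨tq', -, htq'⟩ := exists_isFinite_restrict_quasiSection i f hi hdesc hdv horth hN htf q'
  haveI := hc
  haveI := epi_of_surjective_toSchemeHom c
  -- `g ≫ t_{q'} = 0`
  have h1 : g ≫ tq' = 0 := by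
    rw [← cancel_epi c, comp_zero]
    exact horth q q' hqq' _
  -- `t_{q'} ≫ i_{q'} ≫ f = N • ι_{q'}`
  have h2 : tq' ≫ i q' ≫ f = N • imageι (((v ≫ biproduct.π Y q') ≫ i q') ≫ f) := by
    rw [← Category.assoc tq' (i q') f, htq', Category.assoc (imageι _) t f, htf, Preadditive.comp_nsmul,
      Category.comp_id]
  have h3 : N • (g ≫ imageι (((v ≫ biproduct.π Y q') ≫ i q') ≫ f)) = 0 := by
    rw [← Preadditive.comp_nsmul, ← h2, ← Category.assoc, h1, zero_comp]
  rw [← cancel_mono (imageι (((v ≫ biproduct.π Y q') ≫ i q') ≫ f)), zero_comp]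
  exact hom_eq_zero_of_nsmul_eq_zero hN h3

end AnyField

/-! ## §2 Over a perfect field: quotients and finite covers of `X ⊇ ⨁_q Y_q`, `Y_q ∼ B_q^{n_q+1}` -/

section Perfect

variable [PerfectField K] {Q : Type} [Fintype Q] {B : Q → Motives.AbelianVariety K} {n : Q → ℕ}
  {X Z : Motives.AbelianVariety K} {Y : Q → Motives.AbelianVariety K}

/-- **Every quotient is the sum of the images of the isotypic components** (perfect field): for isotypic components
`i_q : Y_q ↪ X`, `Y_q ∼ B_q^{n_q+1}` (`B_q` simple of positive dimension, pairwise non-isogenous, addition map an isogeny)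
and every surjective `f : X ↠ Z` there are abelian subvarieties `a_q : Z_q ↪ Z` with `range (a_q) = f(Y_q)`
(`range a_q = range (i_q ≫ f)`), pairwise `Hom`-orthogonal, of types `Z_q ∼ B_q^{s_q}` with `s_q ≤ n_q + 1`, whose addition
map `⨁_q Z_q → Z` is an isogeny. [cite: MumfordAV1970, §19 Thm. 1 and Cor. 1–2 (pp. 173–174)]
[cite: Milne1986AbelianVarieties, §12 Prop. 12.1 and its proof (PDF p. 189)] [cite: SilverbergZarhin2015, Def. 2.3 (p. 3) and proof of Lemma 3.3 (p. 5)] -/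
theorem exists_quotientPieces_of_surjective (hB : ∀ q, (B q).IsSimple) (hB0 : ∀ q, 0 < (B q).dim)
    (hni : ∀ q q', q ≠ q' → ¬ IsIsogenous (B q) (B q'))
    (hY : ∀ q, IsIsogenous (Y q) (⨁ fun _ : Fin (n q + 1) ↦ B q)) (i : ∀ q, Y q ⟶ X)
    (hi : ∀ q, IsClosedImmersion (Hom.toSchemeHom (i q))) (hdesc : IsIsogeny (biproduct.desc i))
    (f : X ⟶ Z) [Surjective (Hom.toSchemeHom f)] :
    ∃ (W : Q → Motives.AbelianVariety K) (a : ∀ q, W q ⟶ Z),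
      (∀ q, IsClosedImmersion (Hom.toSchemeHom (a q))) ∧
        (∀ q, Set.range (Hom.toSchemeHom (a q)) = Set.range (Hom.toSchemeHom (i q ≫ f))) ∧ IsIsogeny (biproduct.desc a) ∧
          (∀ q, ∃ s : ℕ, s ≤ n q + 1 ∧ IsIsogenous (W q) (⨁ fun _ : Fin s ↦ B q)) ∧
            ∀ q q', q ≠ q' → ∀ g : W q ⟶ W q', g = 0 := by
  have horth : ∀ q q', q ≠ q' → ∀ g : Y q ⟶ Y q', g = 0 := fun q q' hqq' g ↦
    hom_eq_zero_of_isIsogenous_biproduct_const_of_ne hB hB0 hni hqq' (hY q) (hY q') g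
  obtain ⟨v, m, hm, hdv, hvd⟩ := IsIsogeny.exists_nsmul_inverse_holds hdesc
  obtain ⟨t, N, hN, htf⟩ := exists_quasiSection_of_perfectField f
  refine ⟨fun q ↦ image (((v ≫ biproduct.π Y q) ≫ i q) ≫ f), fun q ↦ imageι _, fun q ↦ inferInstance,
    fun q ↦ by rw [range_toSchemeHom_imageι, range_isotypicProjector_comp_eq i f hdv hm.ne' q],
    isIsogeny_biproduct_desc_imageι_quotientPieces i f hi hdesc hdv hvd horth hm.ne' hN htf, fun q ↦ ?_,
    fun q q' hqq' g ↦ hom_quotientPieces_eq_zero i f hi hdesc hdv horth hm.ne' hN htf hqq' g⟩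
  obtain ⟨c, hc, -⟩ := exists_surjective_comp_imageι_quotientPiece_eq i f hdv hm.ne' q
  haveI := hc
  exact exists_le_isIsogenous_biproduct_const_of_surjective (hB q) (hB0 q) (hY q) c

/-- **Every quotient `X ↠ Z` is `∼ ⨁_q B_q^{s_q}` with `s_q ≤ n_q + 1`**, on the index set of the isotypic components of
`X` (perfect field). [cite: MumfordAV1970, §19 Cor. 1 of Thm. 1 (p. 173)] [cite: Milne1986AbelianVarieties, §12 Prop. 12.1 (PDF p. 189)] -/
theorem exists_isIsogenous_biproduct_powers_le_of_surjective (hB : ∀ q, (B q).IsSimple) (hB0 : ∀ q, 0 < (B q).dim)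
    (hni : ∀ q q', q ≠ q' → ¬ IsIsogenous (B q) (B q'))
    (hY : ∀ q, IsIsogenous (Y q) (⨁ fun _ : Fin (n q + 1) ↦ B q)) (i : ∀ q, Y q ⟶ X)
    (hi : ∀ q, IsClosedImmersion (Hom.toSchemeHom (i q))) (hdesc : IsIsogeny (biproduct.desc i))
    (f : X ⟶ Z) [Surjective (Hom.toSchemeHom f)] :
    ∃ s : Q → ℕ, (∀ q, s q ≤ n q + 1) ∧ IsIsogenous Z (⨁ fun q ↦ ⨁ fun _ : Fin (s q) ↦ B q) := by
  obtain ⟨t, N, hN, htf⟩ := exists_quasiSection_of_perfectField f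
  haveI := isFinite_of_comp_eq_nsmul_id hN htf
  obtain ⟨s, hs, hZ⟩ := exists_isIsogenous_biproduct_powers_le_of_isClosedImmersion hB hB0 hni hY i hi hdesc (imageι t)
  exact ⟨s, hs, (isIsogenous_image_of_isFinite t).trans hZ⟩

/-- Every abelian variety with a FINITE homomorphism `f : Z → X` (e.g. an isogeny onto an abelian subvariety) is
`∼ ⨁_q B_q^{s_q}` with `s_q ≤ n_q + 1` (perfect field; `Z ∼ im f ↪ X`). [cite: MumfordAV1970, §19 Thm. 1 and Cor. 1 (p. 173)]
[cite: Milne1986AbelianVarieties, §12 Prop. 12.1 (PDF p. 189)] -/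
theorem exists_isIsogenous_biproduct_powers_le_of_isFinite (hB : ∀ q, (B q).IsSimple) (hB0 : ∀ q, 0 < (B q).dim)
    (hni : ∀ q q', q ≠ q' → ¬ IsIsogenous (B q) (B q'))
    (hY : ∀ q, IsIsogenous (Y q) (⨁ fun _ : Fin (n q + 1) ↦ B q)) (i : ∀ q, Y q ⟶ X)
    (hi : ∀ q, IsClosedImmersion (Hom.toSchemeHom (i q))) (hdesc : IsIsogeny (biproduct.desc i))
    (f : Z ⟶ X) [IsFinite (Hom.toSchemeHom f)] :
    ∃ s : Q → ℕ, (∀ q, s q ≤ n q + 1) ∧ IsIsogenous Z (⨁ fun q ↦ ⨁ fun _ : Fin (s q) ↦ B q) := by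
  obtain ⟨s, hs, hZ⟩ := exists_isIsogenous_biproduct_powers_le_of_isClosedImmersion hB hB0 hni hY i hi hdesc (imageι f)
  exact ⟨s, hs, (isIsogenous_image_of_isFinite f).trans hZ⟩

/-- `dim Z = Σ_q s_q · dim B_q`, `s_q ≤ n_q + 1`, for every quotient `X ↠ Z` (perfect field).
[cite: MumfordAV1970, §19 Cor. 1 of Thm. 1 (p. 173)] [cite: Milne1986AbelianVarieties, §12 Prop. 12.1 (PDF p. 189)] -/
theorem exists_dim_eq_sum_mul_of_surjective (hB : ∀ q, (B q).IsSimple) (hB0 : ∀ q, 0 < (B q).dim)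
    (hni : ∀ q q', q ≠ q' → ¬ IsIsogenous (B q) (B q'))
    (hY : ∀ q, IsIsogenous (Y q) (⨁ fun _ : Fin (n q + 1) ↦ B q)) (i : ∀ q, Y q ⟶ X)
    (hi : ∀ q, IsClosedImmersion (Hom.toSchemeHom (i q))) (hdesc : IsIsogeny (biproduct.desc i))
    (f : X ⟶ Z) [Surjective (Hom.toSchemeHom f)] :
    ∃ s : Q → ℕ, (∀ q, s q ≤ n q + 1) ∧ Z.dim = ∑ q, s q * (B q).dim := by
  obtain ⟨s, hs, hZ⟩ := exists_isIsogenous_biproduct_powers_le_of_surjective hB hB0 hni hY i hi hdesc f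
  refine ⟨s, hs, ?_⟩
  rw [hZ.dim_eq, dim_biproduct]
  exact Finset.sum_congr rfl fun q _ ↦ by rw [dim_biproduct_const, Fintype.card_fin]

/-- `dim Z = Σ_q s_q · dim B_q`, `s_q ≤ n_q + 1`, for every finite `f : Z → X` (perfect field).
[cite: MumfordAV1970, §19 Cor. 1 of Thm. 1 (p. 173)] [cite: Milne1986AbelianVarieties, §12 Prop. 12.1 (PDF p. 189)] -/
theorem exists_dim_eq_sum_mul_of_isFinite (hB : ∀ q, (B q).IsSimple) (hB0 : ∀ q, 0 < (B q).dim)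
    (hni : ∀ q q', q ≠ q' → ¬ IsIsogenous (B q) (B q'))
    (hY : ∀ q, IsIsogenous (Y q) (⨁ fun _ : Fin (n q + 1) ↦ B q)) (i : ∀ q, Y q ⟶ X)
    (hi : ∀ q, IsClosedImmersion (Hom.toSchemeHom (i q))) (hdesc : IsIsogeny (biproduct.desc i))
    (f : Z ⟶ X) [IsFinite (Hom.toSchemeHom f)] :
    ∃ s : Q → ℕ, (∀ q, s q ≤ n q + 1) ∧ Z.dim = ∑ q, s q * (B q).dim := by
  obtain ⟨s, hs, hZ⟩ := exists_isIsogenous_biproduct_powers_le_of_isFinite hB hB0 hni hY i hi hdesc f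
  refine ⟨s, hs, ?_⟩
  rw [hZ.dim_eq, dim_biproduct]
  exact Finset.sum_congr rfl fun q _ ↦ by rw [dim_biproduct_const, Fintype.card_fin]

end Perfect

end AbelianVariety

end Literature.AlgebraicGeometry.HodgeTheory

end
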